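import Summits.FinalStateConjecture.FinalStateConjecture.Theses.ZeroEnergyKerrOrBomb
import Literature.Geometry.Lorentzian.TrappedZeroEnergyRay
import Literature.Geometry.Lorentzian.GlobalHyperbolicityStrongCausality
import Literature.Geometry.Lorentzian.NonImprisonment
import Literature.Geometry.Lorentzian.CausalityConditionsProofs
import Literature.Geometry.Lorentzian.GeodesicSpeed
import Literature.Geometry.Lorentzian.GeodesicProofs
import Literature.Geometry.Lorentzian.CoordinateFrames

/-!
# `ErgoregionBomb` (crux `stmt-FinalStateConjecture-10691`, route `ZeroEnergyKerrOrBomb`):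
# the trapping clause of the crux is contradictory under global hyperbolicity (negative-side support)

Support file of the crux disprover (cdisprove seat), `sorry`-free. The antecedent of the crux
imprisons an affinely parametrised null geodesic half-ray `γ|[0,∞)` in a compact subset `K` of
SPACETIME (`∀ s ≥ 0, γ s ∈ K`). On the telescope's carrier (Hausdorff, second countable, connected,
boundaryless, `C^∞` metric) this contradicts `IsGloballyHyperbolic` by the classical chain
"globally hyperbolic ⇒ strongly causal (Bernal–Sánchez 2007, Thm. 3.2) ⇒ no endless causal curve is
imprisoned in a compact set (O'Neill 1983, Ch. 14, Lemma 13; Hawking–Ellis 1973, Prop. 6.4.7)",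
applied to the ray read as a future causal curve for `τ` or for `-τ` (the sign of `g(τ, γ')` cannot
change along the ray: a causal vector is never orthogonal to a timelike one, O'Neill Lemma 5.26).
The two causality facts are the tree's named facts
`LorentzianMetric.bernalSanchez_isStronglyCausal_of_isGloballyHyperbolic` and
`LorentzianMetric.IsStronglyCausal.exists_forall_notMem_of_isCompact`, taken as hypotheses at `𝓑`;
the third ingredient — an affinely parametrised geodesic ray with non-vanishing velocity has no
future endpoint (O'Neill 1983, Ch. 5, Lemma 8) — is the hypothesis `hEnd` (not vendored).

* `isGloballyHyperbolic_reverse` — global hyperbolicity is time-reversal invariant;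
  (the side condition `2 ≤ ∞` of the facts is `Literature.Analysis.FluidPDE.two_le_infty`, inlined)
* `trapping_clause_contradictory` — the clause yields `False` (no vacuum, horizon, zero-energy or
  `K ⊆ doc` input);
* `not_hasTrappedZeroEnergyRay_of_facts` — hence the Literature predicate
  `StationaryAFBlackHole.HasTrappedZeroEnergyRay` inlined by the crux is unsatisfiable on globally
  hyperbolic holes: the crux as typed is vacuously true (content-free) and `ZeroEnergyRigidity`'s
  non-trapping hypothesis is automatic. The repair is confinement modulo the stationary flow
  (`StationaryAFBlackHole.HasZeroEnergyRayTrappedModFlow`).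
-/

noncomputable section

set_option linter.dupNamespace false

open Bundle Set Filter
open scoped Manifold Topology

namespace Summit.FinalStateConjecture.FinalStateConjecture.Theorems.ErgoregionBomb.Negative

open Literature.Geometry.Lorentzian

section Reverse

variable {E' : Type*} [NormedAddCommGroup E'] [NormedSpace ℝ E'] {H' : Type*} [TopologicalSpace H']
  {I' : ModelWithCorners ℝ E' H'} {M' : Type*} [TopologicalSpace M'] [ChartedSpace H' M']
  {n' : WithTop ℕ∞}

/-- **Global hyperbolicity is invariant under time reversal**: the causality condition is
(`IsCausallyWellBehaved.reverse`) and the causal diamonds of `-τ` are those of `τ` with `p, q`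
swapped (`causalPast_reverse`). O'Neill 1983, Ch. 14, p. 402 (time duality).
[cite: ONeill1983, Ch. 14, p. 402] -/
theorem isGloballyHyperbolic_reverse [IsManifold I' ((⊤ : ℕ∞) : WithTop ℕ∞) M']
    {g : LorentzianMetric I' n' M'} {τ : TimeOrientation g}
    (h : g.IsGloballyHyperbolic τ) : g.IsGloballyHyperbolic τ.reverse := by
  refine ⟨h.1.reverse, fun p q ↦ ?_⟩
  have e1 : g.causalFuture τ.reverse {p} = g.causalPast τ {p} := rfl
  rw [e1, LorentzianMetric.causalPast_reverse, Set.inter_comm]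
  exact h.2 q p

end Reverse

variable (𝓑 : StationaryAFBlackHole.{0}) [𝓑.metric.HasLeviCivita]

/-- **The trapping clause of the crux is contradictory** (modulo the three facts): on a globally
hyperbolic `𝓑`, no geodesic half-ray `γ|[0,∞)` with null (hence non-zero, causal) velocity stays in
a compact set. `hBS`/`hNI` are the tree's named causality facts instantiated at `𝓑` (both time
orientations); `hEnd` is O'Neill 1983 Ch. 5 Lemma 8 (an affinely parametrised geodesic ray with
non-vanishing velocity has no future endpoint), stated for the telescope. No use of the metric being
vacuum, of the horizon, of `T`, or of `K ⊆ doc`.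
[cite: ONeill1983, Ch. 14 Lemma 13; Ch. 5 Lemma 8 and Lemma 26] -/
theorem trapping_clause_contradictory
    (hBS : ∀ τ : TimeOrientation 𝓑.metric,
      𝓑.metric.bernalSanchez_isStronglyCausal_of_isGloballyHyperbolic τ)
    (hNI : ∀ τ : TimeOrientation 𝓑.metric,
      LorentzianMetric.IsStronglyCausal.exists_forall_notMem_of_isCompact 𝓑.metric τ)
    (hEnd : ∀ γ : ℝ → 𝓑.carrier, IsGeodesicOn 𝓑.metric.leviCivita γ (Set.Ici 0) →
      (∀ s : ℝ, 0 ≤ s → velocity (𝓡 4) γ s ≠ 0) → IsFutureEndless γ (Set.Ici 0))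
    (hgh : 𝓑.metric.IsGloballyHyperbolic 𝓑.timeOrientation)
    {γ : ℝ → 𝓑.carrier} {K : Set 𝓑.carrier}
    (hg : IsGeodesicOn 𝓑.metric.leviCivita γ (Set.Ici 0))
    (hnull : ∀ s : ℝ, 0 ≤ s → 𝓑.metric.IsNull (velocity (𝓡 4) γ s))
    (hK : IsCompact K) (hin : ∀ s : ℝ, 0 ≤ s → γ s ∈ K) : False := by
  set τ := 𝓑.timeOrientation with hτ
  -- the sign function `f(t) = g(τ, γ')(t)`
  set f : ℝ → ℝ := fun t ↦ 𝓑.metric.val (γ t) (τ.vectorField (γ t)) (velocity (𝓡 4) γ t)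
    with hf
  have hcov : 𝓑.metric.toPseudoRiemannianMetric.IsCompatible 𝓑.metric.leviCivita :=
    (PseudoRiemannianMetric.isLeviCivita_leviCivita_holds
      (g := 𝓑.metric.toPseudoRiemannianMetric)).2
  have hmd : ∀ t ∈ Set.Ici (0 : ℝ), MDifferentiableAt 𝓘(ℝ, ℝ) (𝓡 4) γ t := fun t ht ↦
    IsGeodesicOn.mdifferentiableAt_holds hg ht
  have hderiv : ∀ t ∈ Set.Ici (0 : ℝ), ∃ f', HasDerivAt f f' t := by
    intro t ht
    have hXd : MDifferentiableAt (𝓡 4) (𝓡 4).tangent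
        (fun x ↦ (TotalSpace.mk' (EuclideanSpace ℝ (Fin 4)) x (τ.vectorField x) :
          TangentBundle (𝓡 4) 𝓑.carrier)) (γ t) :=
      (τ.contMDiff (γ t)).mdifferentiableAt (by simp)
    exact ⟨_, 𝓑.metric.toPseudoRiemannianMetric.hasDerivAt_val_apply_along hcov
      (V := fun t ↦ τ.vectorField (γ t)) (W := fun t ↦ velocity (𝓡 4) γ t)
      (mdifferentiableAt_lift_comp hXd (hmd t ht)) (hg.1 t ht)⟩
  have hcont : ContinuousOn f (Set.Ici 0) := fun t ht ↦ by
    obtain ⟨f', h⟩ := hderiv t ht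
    exact h.continuousAt.continuousWithinAt
  have hne : ∀ t ∈ Set.Ici (0 : ℝ), f t ≠ 0 := fun t ht ↦
    𝓑.metric.val_ne_zero_of_isTimelike_of_isCausal (τ.isTimelike _) (hnull t ht).isCausal
  -- constant sign on `[0, ∞)`
  have hsign : (∀ t ∈ Set.Ici (0 : ℝ), f t < 0) ∨ (∀ t ∈ Set.Ici (0 : ℝ), 0 < f t) := by
    rcases lt_or_gt_of_ne (hne 0 Set.self_mem_Ici) with h0 | h0
    · refine Or.inl fun t ht ↦ ?_
      by_contra hft
      have hft' : 0 ≤ f t := not_lt.mp hft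
      have hIVT := intermediate_value_Icc (show (0 : ℝ) ≤ t from ht)
        (hcont.mono Set.Icc_subset_Ici_self)
      obtain ⟨s, hs, hs0⟩ := hIVT ⟨h0.le, hft'⟩
      exact hne s (Set.mem_Ici.2 hs.1) hs0
    · refine Or.inr fun t ht ↦ ?_
      by_contra hft
      have hft' : f t ≤ 0 := not_lt.mp hft
      have hIVT := intermediate_value_Icc' (show (0 : ℝ) ≤ t from ht)
        (hcont.mono Set.Icc_subset_Ici_self)
      obtain ⟨s, hs, hs0⟩ := hIVT ⟨hft', h0.le⟩
      exact hne s (Set.mem_Ici.2 hs.1) hs0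
  have hend : IsFutureEndless γ (Set.Ici 0) := hEnd γ hg fun s hs ↦ (hnull s hs).2
  rcases hsign with hneg | hpos
  · -- future-directed: non-imprisonment for `τ`
    have hcurve : 𝓑.metric.IsFutureCausalCurveOn τ γ (Set.Ici 0) := fun t ht ↦
      ⟨hmd t ht, (hnull t ht).isCausal, hneg t ht⟩
    have hsc : 𝓑.metric.IsStronglyCausal τ := hBS τ (WithTop.coe_le_coe.mpr le_top) hgh
    obtain ⟨t, ht, hout⟩ := hNI τ (WithTop.coe_le_coe.mpr le_top) hsc hK Set.ordConnected_Ici hcurve hend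
    exact hout t ht le_rfl (hin t ht)
  · -- past-directed: non-imprisonment for `τ.reverse`
    have hcurve : 𝓑.metric.IsFutureCausalCurveOn τ.reverse γ (Set.Ici 0) := fun t ht ↦
      ⟨hmd t ht, (TimeOrientation.isFutureDirected_reverse_iff _ _).mpr
        ⟨(hnull t ht).isCausal, hpos t ht⟩⟩
    have hsc : 𝓑.metric.IsStronglyCausal τ.reverse :=
      hBS τ.reverse (WithTop.coe_le_coe.mpr le_top) (isGloballyHyperbolic_reverse hgh)
    obtain ⟨t, ht, hout⟩ :=
      hNI τ.reverse (WithTop.coe_le_coe.mpr le_top) hsc hK Set.ordConnected_Ici hcurve hend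
    exact hout t ht le_rfl (hin t ht)

/-- **`HasTrappedZeroEnergyRay` is unsatisfiable under global hyperbolicity** (modulo the three
facts): the Literature predicate inlined by the crux never holds on the telescope. [folklore] -/
theorem not_hasTrappedZeroEnergyRay_of_facts
    (hBS : ∀ τ : TimeOrientation 𝓑.metric,
      𝓑.metric.bernalSanchez_isStronglyCausal_of_isGloballyHyperbolic τ)
    (hNI : ∀ τ : TimeOrientation 𝓑.metric,
      LorentzianMetric.IsStronglyCausal.exists_forall_notMem_of_isCompact 𝓑.metric τ)
    (hEnd : ∀ γ : ℝ → 𝓑.carrier, IsGeodesicOn 𝓑.metric.leviCivita γ (Set.Ici 0) →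
      (∀ s : ℝ, 0 ≤ s → velocity (𝓡 4) γ s ≠ 0) → IsFutureEndless γ (Set.Ici 0))
    (hgh : 𝓑.metric.IsGloballyHyperbolic 𝓑.timeOrientation) :
    ¬ 𝓑.HasTrappedZeroEnergyRay := by
  rintro ⟨γ, K, hg, hz, hK, -, hin⟩
  exact trapping_clause_contradictory 𝓑 hBS hNI hEnd hgh hg (fun s hs ↦ (hz s hs).1) hK hin


end Summit.FinalStateConjecture.FinalStateConjecture.Theorems.ErgoregionBomb.Negative

end
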